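import Literature.MathematicalPhysics.QuantumFieldTheory.BalabanImbrieJaffe1984to88.BIJ88Sect5StatementsPart2

/-!
# `BalabanImbrieJaffe1984to88.BIJ88Interaction298` — T. Bałaban, J. Imbrie, A. Jaffe, *Effective action and cluster properties of the
abelian Higgs model*, Commun. Math. Phys. **114** (1988) 257–315 [BalabanImbrieJaffe1988], Sect. 5.10 *The Interaction for the Fluctuation
Fields*, p. 298 [PDF 42]: THE REGROUPING DISPLAY DEFINING `V^{(k)}` AND `Σ_□ W₃^{(k)}(□)`, and the observable split `F^{(m̄)} = F^{m̄} + F̃̃`,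
AS EXACT BOOKKEEPING.  The print, verbatim: *"We localize all vertices to Λ̄₈^{(k)}; vector field legs at a vertex are multiplied by a smooth
function θ̄_k changing from 0 to 1 in a neighborhood of Λ̄₈^{(k)c}. We also remove all diagrams whose combined order in λ^{1/2} and e is
greater than n̄. We still consider all P_k vertices together; any P^{(l)}_k vertex is considered as one power of λ. Each mass renormalization
counterterm is written graphically and powers counted accordingly. The result is the interaction V^{(k)}(Λ₈^{(k)}, u_{k+1}, A^{(k)}, φ^{(k)}), and
𝒫_{k,loc}(Λ₈^{(k−1)}, ũ_{k+1}) + R^{(k)}(u_{k+1}, θ_kH_{k,loc}A^{(k)}) + Q^{(k)}(u_{k+1}, θ_kH_{k,loc}A^{(k)})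
= 𝒫_{k,loc}(Λ₈^{(k−1)}, Λ₈^{(k)c}, ũ_{k+1}) + R^{(k)}(Λ₈^{(k)c}, u_{k+1}, θ_kH_{k,loc}A^{(k)}) + Q^{(k)}(Λ₈^{(k)c}, u_{k+1}, θ_kH_{k,loc}A^{(k)})
+ V^{(k)}(Λ₈^{(k)}, u_{k+1}, A^{(k)}, φ^{(k)}) + Σ_□ W₃^{(k)}(□).
Here in writing Λ₈^{(k)c} we mean that only the terms without proper localizations are included. The terms W₃^{(k)}(□) contain terms localized
near the r(e_k)-cube □ which involve the small kernel w₈ or have high powers of coupling constants. We have an estimate |W₃^{(k)}(□)| ≤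
[e^β(L^kε/ε₀)^{1/4−α}]^{n̄+1} ≤ e^{n̄β}(L^kε/ε₀)^κ … In a similar fashion we modify the external scalar fields in F^{(m̄)}_{k,loc} and eliminate
diagrams of order higher than m̄. Thus we write F^{(m̄)}_{k,loc}(X_σ) = F^{m̄}_{k,loc}(X_σ) + F̃̃_{k,loc}(X_σ), with F̃̃_{k,loc}(X_σ) containing the
w₈ terms and the higher order terms, and satisfying F̃̃_{k,loc}(X_σ) ≤ c(F)."*

statement-level skeleton of published theorems with citation tags; proofs where landed; nothing here is a claim about the Yang–Mills mass gap

THE READING (declared; the bookkeeping of this seat's gen-12 `BIJ88Extraction311` for the analogous p. 311 extraction).  At fixed fields the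
three perturbative objects `𝒫_{k,loc}`, `R^{(k)}`, `Q^{(k)}` are finite sums of DIAGRAM TERMS; after the operations of the paragraph (the
external-field replacement of `BIJ88ExternalField298` which splits a term into its main part and its `w₈`-part, and the `θ̄_k`-localization of
the vertices which splits a term into its properly localized part and the rest) the terms are indexed by a finite type `Γ`, each carrying: its
SOURCE `src γ ∈ {𝒫, R, Q}`, its value `t γ : ℝ`, the flag `proper γ` (*"terms with proper localizations"* in `Λ₈^{(k)}` — the others are what
*"writing Λ₈^{(k)c}"* keeps), its combined ORDER `ord γ : ℕ` in `λ^{1/2}` and `e` (P_k vertices counted as printed), the flag `usesW8 γ` (*"involve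
the small kernel w₈"*), and the `r(e_k)`-cube `cube γ` near which a proper term is localized.  Then, BY DEFINITION (defs with bodies):
`improper src₀` := the sum of the non-proper terms of source `src₀` (the three `Λ₈^{(k)c}`-objects), **`V`** := the sum of the proper terms of
order `≤ n̄` without `w₈` (*"The result is the interaction V^{(k)}"*), **`W3 □`** := the sum of the proper terms at the cube `□` which involve
`w₈` OR have order `> n̄` (*"which involve the small kernel w₈ or have high powers of coupling constants"*); and the display is the exact
regrouping `interaction298`.  The same bookkeeping gives the observable split `Fmbar`/`Ftt`, `obs_split298`.

WHAT IS PROVED (defs with bodies + theorems; 0 `sorry`; no `Prop`-valued fact; standard axioms): `total_eq_improper_add_proper`,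
`proper_eq_V_add_rest`, `rest_eq_sum_W3` (regrouping of the high-order/`w₈` proper terms by cubes, `Finset.sum_fiberwise`), **`interaction298`**
(the display), `interaction298_sources` (with the left side written as the three printed sums `𝒫 + R + Q`), `W3_eq_zero_of_no_terms`, and
`obs_split298` (`F^{(m̄)} = F^{m̄} + F̃̃`).  The `W₃` ESTIMATE is r16's leaf `BIJ88Sect5StatementsPart2.IneqW3` (its second inequality p36's
`BIJ88W3Chain298`), stated here for THIS `W3` as the displayed hypothesis shape `ineqW3_iff` only — NOT proved (the §3 perturbation-estimate
input class, rows C2.Txt@260/C2.Claim@303; print: *"This estimate comes from our analysis of the perturbation expansion and the restrictions on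
the fields"*).  HONEST SCOPE: bookkeeping only — which diagrams exist, their orders, the `θ̄_k` and the localization cubes are data; nothing is
claimed about sizes; *"F̃̃ ≤ c(F)"* and the `V^{(k)}`, `Q^{(k)}`, `R^{(k)}` bounds are not asserted.  NOT summit progress; NOT continuum; NOT Clay.
CITATION HEADER (lean-in-tree rule).  Part of the lit-balaban TYPED SKELETON (HOME `run/shared/lean/pub/lit-balaban/`), PHASE-2 proof seat p31
gen 13 (unit `lit-balaban-p31-g13`; TAKING #2 line HOME/STATUS.md, free-target protocol G.5-34(d), own lane).  Row served: **`C2.Def§5.10`**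
(owner r16, `HOME/lit-balaban-r16/ROWS-C2-part2.md`: *"rest of §5.10 absent"*) — the third and the last display of p. 298 and the sentences
quoted; companion of this seat's `BIJ88ExternalField298` (first two displays).  PDF held: `paper:balaban1988-cmp114-bij-abelian-higgs-effective-action`
(journal page = PDF page + 256); p. 298 [PDF 42] re-read this session as an image (`HOME/lit-balaban-r16/renders/cmp114/original-p042-x2.png`).
Imports r16's `BIJ88Sect5StatementsPart2` only (the leaf `IneqW3`); sub-namespace `…BIJ88Interaction298`; nothing re-declared, nothing restated.
-/

namespace Literature.MathematicalPhysics.QuantumFieldTheory.BalabanImbrieJaffe1984to88.BIJ88Interaction298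

open scoped BigOperators
open Finset

noncomputable section

/-- The three sources of diagram terms on p. 298: `𝒫_{k,loc}`, `R^{(k)}`, `Q^{(k)}`. [cite: BalabanImbrieJaffe1988, p.298 (Sect. 5.10)] -/
inductive Src where
  | P : Src
  | R : Src
  | Q : Src
  deriving DecidableEq, Fintype

/-- **THE DIAGRAM-TERM BOOKKEEPING OF p. 298** (the reading of the header): a finite family of terms `Γ`, each with its source, its value at
the fields, the flag *"proper localization"* in `Λ₈^{(k)}`, its combined order in `λ^{1/2}` and `e`, the flag *"involves the small kernel w₈"*,
and the `r(e_k)`-cube near which it is localized. [cite: BalabanImbrieJaffe1988, p.298 (Sect. 5.10)] -/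
structure Terms (Γ Cube : Type*) where
  /-- which of `𝒫_{k,loc}`, `R^{(k)}`, `Q^{(k)}` the term comes from -/
  src : Γ → Src
  /-- the value of the term at the (fixed) fields -/
  t : Γ → ℝ
  /-- *"terms with proper localizations"* (in `Λ₈^{(k)}`) -/
  proper : Γ → Bool
  /-- combined order in `λ^{1/2}` and `e` -/
  ord : Γ → ℕ
  /-- *"involve the small kernel w₈"* -/
  usesW8 : Γ → Bool
  /-- the `r(e_k)`-cube near which a proper term is localized -/
  cube : Γ → Cube

namespace Terms

variable {Γ Cube : Type*} [Fintype Γ] (D : Terms Γ Cube) (nbar : ℕ)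

/-- The left side of the display: the sum of ALL terms, `𝒫_{k,loc} + R^{(k)} + Q^{(k)}`. [cite: BalabanImbrieJaffe1988, p.298 (Sect. 5.10)] -/
def total : ℝ := ∑ γ, D.t γ

/-- One printed source summed: `𝒫_{k,loc}(Λ₈^{(k−1)}, ũ_{k+1})`, resp. `R^{(k)}(…)`, resp. `Q^{(k)}(…)`. [cite: BalabanImbrieJaffe1988, p.298 (Sect. 5.10)] -/
def source (s : Src) : ℝ := ∑ γ ∈ univ.filter (fun γ => D.src γ = s), D.t γ

/-- **`𝒫_{k,loc}(Λ₈^{(k−1)}, Λ₈^{(k)c}, ũ_{k+1})`, `R^{(k)}(Λ₈^{(k)c}, …)`, `Q^{(k)}(Λ₈^{(k)c}, …)`** — *"in writing Λ₈^{(k)c} we mean that only the terms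
without proper localizations are included"*: the non-proper terms of source `s`. [cite: BalabanImbrieJaffe1988, p.298 (Sect. 5.10)] -/
def improper (s : Src) : ℝ := ∑ γ ∈ univ.filter (fun γ => D.proper γ = false ∧ D.src γ = s), D.t γ

/-- **THE INTERACTION `V^{(k)}(Λ₈^{(k)}, u_{k+1}, A^{(k)}, φ^{(k)})`, DEFINED**: the properly localized terms of combined order `≤ n̄` not involving
`w₈` (*"We localize all vertices to Λ̄₈^{(k)} … We also remove all diagrams whose combined order in λ^{1/2} and e is greater than n̄ … The result is
the interaction V^{(k)}"*). [cite: BalabanImbrieJaffe1988, p.298 (Sect. 5.10)] -/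
def V : ℝ := ∑ γ ∈ univ.filter (fun γ => D.proper γ = true ∧ D.ord γ ≤ nbar ∧ D.usesW8 γ = false), D.t γ

/-- The predicate *"involve the small kernel w₈ or have high powers of coupling constants"* on proper terms. [cite: BalabanImbrieJaffe1988, p.298 (Sect. 5.10)] -/
def irrelevant (γ : Γ) : Prop := D.proper γ = true ∧ (nbar < D.ord γ ∨ D.usesW8 γ = true)

/-- kernel: the predicate *"involve the small kernel w₈ or have high powers of coupling constants"* is decidable (finite bookkeeping).
[cite: BalabanImbrieJaffe1988, p.298 (Sect. 5.10)] -/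
instance instDecidablePredIrrelevant : DecidablePred (D.irrelevant nbar) := fun γ => by unfold irrelevant; infer_instance

/-- kernel: all terms = non-proper + proper. [cite: BalabanImbrieJaffe1988, p.298 (Sect. 5.10)] -/
theorem total_eq_improper_add_proper :
    D.total = (∑ γ ∈ univ.filter (fun γ => D.proper γ = false), D.t γ) + ∑ γ ∈ univ.filter (fun γ => D.proper γ = true), D.t γ := by
  unfold total
  rw [← sum_filter_add_sum_filter_not univ (fun γ => D.proper γ = false)]
  congr 1
  refine sum_congr ?_ fun _ _ => rfl
  ext γ
  simp

/-- kernel: the non-proper terms are the three `Λ₈^{(k)c}`-objects. [cite: BalabanImbrieJaffe1988, p.298 (Sect. 5.10)] -/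
theorem improper_sum :
    (∑ γ ∈ univ.filter (fun γ => D.proper γ = false), D.t γ) = D.improper Src.P + D.improper Src.R + D.improper Src.Q := by
  have h : (∑ γ ∈ univ.filter (fun γ => D.proper γ = false), D.t γ) = ∑ s, D.improper s := by
    unfold improper
    rw [← sum_fiberwise_of_maps_to (g := D.src) (t := (univ : Finset Src)) (fun _ _ => mem_univ _)]
    simp only [filter_filter]
  have huniv : (univ : Finset Src) = {Src.P, Src.R, Src.Q} := by decide
  rw [h, huniv, sum_insert (by decide), sum_insert (by decide), sum_singleton, add_assoc]

/-- kernel: the proper terms = `V^{(k)}` + the irrelevant proper terms. [cite: BalabanImbrieJaffe1988, p.298 (Sect. 5.10)] -/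
theorem proper_eq_V_add_rest :
    (∑ γ ∈ univ.filter (fun γ => D.proper γ = true), D.t γ) = D.V nbar + ∑ γ ∈ univ.filter (D.irrelevant nbar), D.t γ := by
  unfold V
  rw [← sum_filter_add_sum_filter_not (univ.filter fun γ => D.proper γ = true) (fun γ => D.ord γ ≤ nbar ∧ D.usesW8 γ = false)]
  simp only [filter_filter]
  congr 1
  refine sum_congr ?_ fun _ _ => rfl
  ext γ
  simp only [mem_filter, mem_univ, true_and, irrelevant, not_and_or, not_le, Bool.not_eq_false]

/-- kernel: the left side written as the three printed sums, `𝒫_{k,loc} + R^{(k)} + Q^{(k)}`. [cite: BalabanImbrieJaffe1988, p.298 (Sect. 5.10)] -/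
theorem total_eq_sources : D.total = D.source Src.P + D.source Src.R + D.source Src.Q := by
  unfold total source
  rw [← sum_fiberwise_of_maps_to (g := D.src) (t := (univ : Finset Src)) (s := (univ : Finset Γ)) (fun _ _ => mem_univ _)]
  have huniv : (univ : Finset Src) = {Src.P, Src.R, Src.Q} := by decide
  rw [huniv, sum_insert (by decide), sum_insert (by decide), sum_singleton, add_assoc]

section Cubes

variable [DecidableEq Cube]

/-- **`W₃^{(k)}(□)`, DEFINED**: *"The terms W₃^{(k)}(□) contain terms localized near the r(e_k)-cube □ which involve the small kernel w₈ or have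
high powers of coupling constants"* — the irrelevant proper terms localized at `□`. [cite: BalabanImbrieJaffe1988, p.298 (Sect. 5.10)] -/
def W3 (X : Cube) : ℝ := ∑ γ ∈ univ.filter (fun γ => D.irrelevant nbar γ ∧ D.cube γ = X), D.t γ

/-- kernel: a cube near which no irrelevant proper term is localized carries `W₃^{(k)}(□) = 0`. [cite: BalabanImbrieJaffe1988, p.298 (Sect. 5.10)] -/
theorem W3_eq_zero_of_no_terms {X : Cube} (h : ∀ γ, D.irrelevant nbar γ → D.cube γ ≠ X) : D.W3 nbar X = 0 := by
  unfold W3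
  refine sum_eq_zero fun γ hγ => ?_
  simp only [mem_filter, mem_univ, true_and] at hγ
  exact absurd hγ.2 (h γ hγ.1)

variable [Fintype Cube]

/-- kernel: the irrelevant proper terms regrouped by their cubes, `Σ_□ W₃^{(k)}(□)`. [cite: BalabanImbrieJaffe1988, p.298 (Sect. 5.10)] -/
theorem rest_eq_sum_W3 : (∑ γ ∈ univ.filter (D.irrelevant nbar), D.t γ) = ∑ X, D.W3 nbar X := by
  unfold W3
  rw [← sum_fiberwise_of_maps_to (g := D.cube) (t := (univ : Finset Cube)) (fun _ _ => mem_univ _)]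
  simp only [filter_filter]

/-- **THE p. 298 DISPLAY, PROVED (exact regrouping)**: `𝒫_{k,loc} + R^{(k)} + Q^{(k)} = 𝒫_{k,loc}(Λ₈^{(k)c}) + R^{(k)}(Λ₈^{(k)c}) + Q^{(k)}(Λ₈^{(k)c})
+ V^{(k)} + Σ_□ W₃^{(k)}(□)` — all terms (left) = the non-proper ones by source + the proper low-order `w₈`-free ones + the irrelevant proper ones
grouped by cubes. [cite: BalabanImbrieJaffe1988, p.298 (Sect. 5.10)] -/
theorem interaction298 :
    D.total = D.improper Src.P + D.improper Src.R + D.improper Src.Q + D.V nbar + ∑ X, D.W3 nbar X := by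
  rw [D.total_eq_improper_add_proper, D.improper_sum, D.proper_eq_V_add_rest nbar, D.rest_eq_sum_W3 nbar]
  ring

/-- **The display with the printed left side**: `𝒫_{k,loc}(Λ₈^{(k−1)}, ũ_{k+1}) + R^{(k)}(u_{k+1}, θ_kH_{k,loc}A^{(k)}) + Q^{(k)}(u_{k+1}, θ_kH_{k,loc}A^{(k)})
= 𝒫_{k,loc}(…, Λ₈^{(k)c}, …) + R^{(k)}(Λ₈^{(k)c}, …) + Q^{(k)}(Λ₈^{(k)c}, …) + V^{(k)}(Λ₈^{(k)}, u_{k+1}, A^{(k)}, φ^{(k)}) + Σ_□ W₃^{(k)}(□)`.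
[cite: BalabanImbrieJaffe1988, p.298 (Sect. 5.10)] -/
theorem interaction298_sources :
    D.source Src.P + D.source Src.R + D.source Src.Q
      = D.improper Src.P + D.improper Src.R + D.improper Src.Q + D.V nbar + ∑ X, D.W3 nbar X := by
  rw [← D.total_eq_sources, D.interaction298 nbar]

end Cubes

end Terms

/-- **The `W₃` estimate is r16's leaf, for THIS `W₃`** (shape only, NOT proved here — *"This estimate comes from our analysis of the perturbation
expansion and the restrictions on the fields"*): `IneqW3 Cube (W3 nbar) θ n̄` reads `∀ □, |W₃^{(k)}(□)| ≤ θ^{n̄+1}`, `θ = e^β(L^kε/ε₀)^{1/4−α}`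
(`BIJ88Sect5StatementsPart2.vertexFactor`; the chain to `e^{n̄β}(L^kε/ε₀)^κ` is p36's `BIJ88W3Chain298.ineqW3_chain`).
[cite: BalabanImbrieJaffe1988, p.298 (Sect. 5.10)] -/
theorem Terms.ineqW3_iff {Γ : Type*} {Cube : Type} [Fintype Γ] [DecidableEq Cube] (D : Terms Γ Cube) (nbar : ℕ) (θ : ℝ) :
    BIJ88Sect5StatementsPart2.IneqW3 Cube (D.W3 nbar) θ nbar ↔ ∀ X : Cube, |D.W3 nbar X| ≤ θ ^ (nbar + 1) :=
  Iff.rfl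

/-! ## The observable split `F^{(m̄)}_{k,loc}(X_σ) = F^{m̄}_{k,loc}(X_σ) + F̃̃_{k,loc}(X_σ)` (last display of p. 298) -/

/-- The diagram terms of ONE observable factor `F^{(m̄)}_{k,loc}(X_σ)` after the modification of the external scalar fields: value, order in
the couplings, *"w₈"*-flag. [cite: BalabanImbrieJaffe1988, p.298 (Sect. 5.10)] -/
structure ObsTerms (Γ : Type*) where
  /-- the value of the term at the fields -/
  t : Γ → ℝ
  /-- order of the diagram -/
  ord : Γ → ℕ
  /-- *"the w₈ terms"* -/
  usesW8 : Γ → Bool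

namespace ObsTerms

variable {Γ : Type*} [Fintype Γ] (O : ObsTerms Γ) (mbar : ℕ)

/-- `F^{(m̄)}_{k,loc}(X_σ)` — all terms. [cite: BalabanImbrieJaffe1988, p.298 (Sect. 5.10)] -/
def Ftotal : ℝ := ∑ γ, O.t γ

/-- **`F^{m̄}_{k,loc}(X_σ)`, DEFINED**: the terms of order `≤ m̄` without `w₈` (*"eliminate diagrams of order higher than m̄"*).
[cite: BalabanImbrieJaffe1988, p.298 (Sect. 5.10)] -/
def Fmbar : ℝ := ∑ γ ∈ univ.filter (fun γ => O.ord γ ≤ mbar ∧ O.usesW8 γ = false), O.t γ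

/-- **`F̃̃_{k,loc}(X_σ)`, DEFINED**: *"containing the w₈ terms and the higher order terms"*. [cite: BalabanImbrieJaffe1988, p.298 (Sect. 5.10)] -/
def Ftt : ℝ := ∑ γ ∈ univ.filter (fun γ => mbar < O.ord γ ∨ O.usesW8 γ = true), O.t γ

/-- **The last display of p. 298, PROVED (exact regrouping)**: `F^{(m̄)}_{k,loc}(X_σ) = F^{m̄}_{k,loc}(X_σ) + F̃̃_{k,loc}(X_σ)`.
[cite: BalabanImbrieJaffe1988, p.298 (Sect. 5.10)] -/
theorem obs_split298 : O.Ftotal = O.Fmbar mbar + O.Ftt mbar := by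
  unfold Ftotal Fmbar Ftt
  rw [← sum_filter_add_sum_filter_not univ (fun γ => O.ord γ ≤ mbar ∧ O.usesW8 γ = false)]
  congr 1
  refine sum_congr ?_ fun _ _ => rfl
  ext γ
  simp only [mem_filter, mem_univ, true_and, not_and_or, not_le, Bool.not_eq_false]

end ObsTerms

end

end Literature.MathematicalPhysics.QuantumFieldTheory.BalabanImbrieJaffe1984to88.BIJ88Interaction298
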